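import Mathlib.LinearAlgebra.Projectivization.Basic
import Mathlib.GroupTheory.Coset.Basic
import Literature.NumberTheory.Automorphic.DoubledUnitaryRankOneSL2Model
import HarnessLib

/-!
# The rank-one doubled unitary group is `SL₂` (II): `U(E) = M(E) · φ(SL₂(F))` and `P(F) \ U(E) ≃ ℙ¹(F)` by the bottom row

Topic `NumberTheory/Automorphic`; namespace `Literature.NumberTheory.Automorphic.DoubledUnitary` (grouping sub-namespace
`RankOneSL2`).  KERNEL only: proved theorems, no definition, no named fact, no `sorry`.

Setting: the SPLIT MODEL of the doubled hermitian plane at RANK ONE — a commutative ring `S` with a ring endomorphism `τ`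
(the conjugation of a quadratic algebra `S ⊇ R`, `τ|_R = id`), an invertible `δ ∈ S` with `τ δ = −δ` (a «`√d`»), and the
`τ`-hermitian form `J₁ = !![0, 1; 1, 0]` on `S²` (the tree's `antidiagForm 1` on `Fin 1 ⊕ Fin 1`, re-enumerated on `Fin 2`:
`submatrix_antidiag_eq_antidiagForm_one`), with unitary group `U = unitaryGroupOfForm τ J₁ ≤ GL₂(S)`
(`UnitaryGroupAutomorphicRep`) and Siegel parabolic `P` = the block-upper elements (`g₁₀ = 0`; supplied by the consumer as a
`Subgroup` with this membership criterion).

MAIN RESULTS (sequel of ★ `DoubledUnitaryRankOneSL2Model` (I): there `φ_δ : SL₂(R) →* U(τ, J₁)(S)`, `g ↦ D g D⁻¹`, is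
characterised by its entries `hφ` and shown to have image `SU`; here `F → E` are FIELDS, `τ` an involution of `E` with fixed
field `F`, `τ δ = −δ`) — [PlatonovRapinchuk1994, §2.3]; [GelbartRogawski1991, §3]; [Weil1965, n° 39 (30)]:
* §3 the two-line HILBERT 90 `τ u · u = 1 ⇒ ∃ z ≠ 0, z = u · τ z` (`z = 1 + u`, or `z = δ` if `u = −1`;
  `exists_eq_mul_map_of_norm_eq_one`), the Levi elements `m(z) = diag(z, (τ z)⁻¹) ∈ U` (`levi_unitary`), the norm-one
  determinant (`map_det_mul_det_eq_one`), and **`U(E) = M(E) · φ(SL₂(F))`** (`exists_levi_mul_sl2`: every `τ`-unitary `x`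
  is `m · φ g` with `m` a Levi element);
* §4 for any subgroup `P ≤ U` with `x ∈ P ↔ x₁₀ = 0` (the Siegel ∕ Borel parabolic, supplied by the consumer — e.g. the
  `P` field of the E-2 child's `SiegelEisensteinCarrier`): `φ g' (φ g)⁻¹ ∈ P ↔ [g₁] = [g'₁]` in `ℙ¹(F)` (bottom rows
  proportional; `sl2Hom_mul_inv_mem_iff`), and **`ℙ¹(F) ≃ P \ U(E)`**, `[c : d] ↦ P · φ(any g with bottom row (c, d))`
  (`exists_equiv_projectivization_rightCoset`, with the `tsum` re-indexing corollary
  `exists_tsum_rightCoset_eq_tsum_projectivization`) — the index set `P_U(F) \ U(W ⊕ W⁻)(F)` of the rank-one Siegel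
  Eisenstein series IS `ℙ¹(F)` = Mathlib `Projectivization F (Fin 2 → F)`, the index type of the tree's ★
  `summable_mirabolicEisenstein` (`MirabolicEisensteinSeries`) at `n = 2`.
Elementary helpers ([Lang2002, XIII §8]: `SL₂(F)` acts transitively on `ℙ¹(F)` with isotropy group `B`): `sl2_row_one_ne_zero`,
`exists_sl2_row_one_eq` (every non-zero vector is the bottom row of an `SL₂` matrix); private: `[v] = [w] ↔ v₀ w₁ = v₁ w₀`.

Written for the Hodge-CM cell `pub/hodgecm-mathlib`, floor 0, E-2 child line `F0_E2SiegelWeilWeilRange` of crux H413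
(stmt-HodgeConjecture-24833), piece (1) ALG of the SW2a dossier, file (II) (A-p16 (g17), 2026-08-31; F0P4-plan (g3) word 00:24:30Z).
Companion (cited, not restated): ★ `UnitaryGroupDoubledSiegelOrbit` (F0P4-p08: `P_Δ \ H ≃ U(W) = E¹` in the diagonal model
`S ⊕ −S`; the two models are Cayley-conjugate, ★ `UnitaryGroupDoubledSiegelBruhat` §4).  HC_CM is proved only modulo the
printed citations until rung 0 closes; this file discharges none of them.

## References
* [PlatonovRapinchuk1994] V. Platonov, A. Rapinchuk, *Algebraic Groups and Number Theory* (1994), §2.3 (unitary groups of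
  hermitian forms over quadratic extensions; the quasi-split `SU₂` is `SL₂`).
* [GelbartRogawski1991] S. Gelbart, J. Rogawski, *L-functions and Fourier–Jacobi coefficients for the unitary group U(3)*,
  Invent. Math. 105 (1991), §3 (the quasi-split `U(1,1)` and its Siegel parabolic).
* [Kudla1994] S. S. Kudla, Israel J. Math. 87 (1994) 361–401, §3.
* [Weil1965] A. Weil, Acta Math. 113 (1965) 1–87, n° 39 (30) (the Eisenstein–Siegel series as a sum over `P(k)\G(k)`).
* [Lang2002] S. Lang, *Algebra*, rev. 3rd ed., GTM 211 (2002), VI §6 Thm. 6.1 (Hilbert's Theorem 90), XIII §8 (`SL₂(F)` on `ℙ¹(F)`).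
-/

set_option autoImplicit false

noncomputable section

open scoped Matrix MatrixGroups
open Matrix

namespace Literature.NumberTheory.Automorphic

namespace DoubledUnitary

namespace RankOneSL2

/-! ## §3 Over fields `F → E`: Hilbert 90 in two lines, the Levi elements, and `U(E) = M(E) · φ(SL₂(F))` -/

section Fields

variable {F E : Type*} [Field F] [Field E] {f : F →+* E} {τ : E →+* E} {δ : Eˣ}

/-- **Hilbert 90 for a quadratic involution, two-line form**: if `τ u · u = 1` then `u = z ∕ τ z` for some `z ≠ 0` —
namely `z = 1 + u` (`u · τ(1 + u) = u + u τu = u + 1`), or `z = δ` when `u = −1` (`τ δ = −δ`).  No Galois cohomology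
is used (Hilbert's Theorem 90 for the cyclic extension `E ∕ F` in its explicit degree-two form). [cite: Lang2002, VI §6 Thm. 6.1] -/
theorem exists_eq_mul_map_of_norm_eq_one (hδ : τ (δ : E) = -(δ : E)) {u : E} (hu : τ u * u = 1) :
    ∃ z : E, z ≠ 0 ∧ z = u * τ z := by
  by_cases h : 1 + u = 0
  · have hu1 : u = -1 := by linear_combination h
    refine ⟨δ, δ.ne_zero, ?_⟩
    rw [hδ, hu1]; ring
  · refine ⟨1 + u, h, ?_⟩
    rw [map_add, map_one]
    linear_combination -hu

/-- The LEVI ELEMENT `m(z) = diag(z, (τ z)⁻¹)` is `τ`-unitary for `J₁` (for `τ` an involution and `z ≠ 0`).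
[cite: GelbartRogawski1991, §3] -/
theorem levi_unitary (hτ : ∀ x, τ (τ x) = x) {z : E} (hz : z ≠ 0) :
    ((!![z, 0; 0, (τ z)⁻¹] : Matrix (Fin 2) (Fin 2) E).map τ)ᵀ * !![(0 : E), 1; 1, 0] * !![z, 0; 0, (τ z)⁻¹] =
      !![(0 : E), 1; 1, 0] := by
  have hτz : τ z ≠ 0 := (map_ne_zero τ).2 hz
  ext i j
  fin_cases i <;> fin_cases j <;>
    simp [Matrix.mul_apply, Fin.sum_univ_two, Matrix.map_apply, map_inv₀, hτ, hz, hτz]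

/-- `det m(z) = z · (τ z)⁻¹`. [folklore] -/
private theorem det_levi (z : E) : Matrix.det (!![z, 0; 0, (τ z)⁻¹] : Matrix (Fin 2) (Fin 2) E) = z * (τ z)⁻¹ := by
  rw [Matrix.det_fin_two]; simp

/-- The determinant of a `τ`-unitary matrix has `τ`-norm one: `τ(det x) · det x = 1` (take determinants in
`(τ x)ᵀ J₁ x = J₁`). [cite: PlatonovRapinchuk1994, §2.3] -/
theorem map_det_mul_det_eq_one {x : GL (Fin 2) E}
    (hx : x ∈ unitaryGroupOfForm τ (!![(0 : E), 1; 1, 0] : Matrix (Fin 2) (Fin 2) E)) :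
    τ (Matrix.det (x : Matrix (Fin 2) (Fin 2) E)) * Matrix.det (x : Matrix (Fin 2) (Fin 2) E) = 1 := by
  have h := congrArg Matrix.det (mem_unitaryGroupOfForm_iff.1 hx)
  rw [Matrix.det_mul, Matrix.det_mul, Matrix.det_transpose, ← RingHom.mapMatrix_apply, ← RingHom.map_det] at h
  have hJ : Matrix.det (!![(0 : E), 1; 1, 0] : Matrix (Fin 2) (Fin 2) E) = -1 := by
    rw [Matrix.det_fin_two]; simp
  rw [hJ] at h
  linear_combination -h

variable {φ : SL(2, F) →* unitaryGroupOfForm τ (!![(0 : E), 1; 1, 0] : Matrix (Fin 2) (Fin 2) E)}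
  (hφ : ∀ g : SL(2, F), (((φ g : unitaryGroupOfForm τ (!![(0 : E), 1; 1, 0] : Matrix (Fin 2) (Fin 2) E)) :
    GL (Fin 2) E) : Matrix (Fin 2) (Fin 2) E) =
      !![f (g 0 0), f (g 0 1) * ((δ⁻¹ : Eˣ) : E); (δ : E) * f (g 1 0), f (g 1 1)])
include hφ

/-- **`U(τ, J₁)(E) = M(E) · φ(SL₂(F))`**: every `τ`-unitary `x` is a Levi element `m(z) = diag(z, (τ z)⁻¹)` times the image
of a matrix of `SL₂(F)` (Hilbert 90 on `det x`, then §2).  Hypotheses: `τ` an involution whose fixed field is `f(F)`,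
`τ δ = −δ`. [cite: PlatonovRapinchuk1994, §2.3] -/
theorem exists_levi_mul_sl2 (hτ : ∀ x, τ (τ x) = x) (hfix : ∀ s : E, τ s = s → ∃ r : F, f r = s)
    (hδ : τ (δ : E) = -(δ : E))
    (x : unitaryGroupOfForm τ (!![(0 : E), 1; 1, 0] : Matrix (Fin 2) (Fin 2) E)) :
    ∃ (m : unitaryGroupOfForm τ (!![(0 : E), 1; 1, 0] : Matrix (Fin 2) (Fin 2) E)) (z : E) (g : SL(2, F)),
      z ≠ 0 ∧ ((m : GL (Fin 2) E) : Matrix (Fin 2) (Fin 2) E) = !![z, 0; 0, (τ z)⁻¹] ∧ x = m * φ g := by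
  set X : Matrix (Fin 2) (Fin 2) E := ((x : GL (Fin 2) E) : Matrix (Fin 2) (Fin 2) E) with hX
  obtain ⟨z, hz, hzu⟩ := exists_eq_mul_map_of_norm_eq_one hδ (map_det_mul_det_eq_one x.2)
  have hτz : τ z ≠ 0 := (map_ne_zero τ).2 hz
  -- the Levi element as a unitary element
  set Lm : Matrix (Fin 2) (Fin 2) E := !![z, 0; 0, (τ z)⁻¹] with hLm
  have hLdet : Lm.det ≠ 0 := by
    rw [hLm, det_levi]; exact mul_ne_zero hz (inv_ne_zero hτz)
  let L : GL (Fin 2) E := Matrix.GeneralLinearGroup.mkOfDetNeZero Lm hLdet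
  have hLval : (L : Matrix (Fin 2) (Fin 2) E) = Lm := rfl
  have hLmem : L ∈ unitaryGroupOfForm τ (!![(0 : E), 1; 1, 0] : Matrix (Fin 2) (Fin 2) E) := by
    rw [mem_unitaryGroupOfForm_iff, hLval, hLm]
    exact levi_unitary hτ hz
  -- `L⁻¹ x` has determinant one, hence is `φ g`
  let y : unitaryGroupOfForm τ (!![(0 : E), 1; 1, 0] : Matrix (Fin 2) (Fin 2) E) := ⟨L, hLmem⟩⁻¹ * x
  have hydet : Matrix.det (((y : unitaryGroupOfForm τ _) : GL (Fin 2) E) : Matrix (Fin 2) (Fin 2) E) = 1 := by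
    have hy : (((y : unitaryGroupOfForm τ _) : GL (Fin 2) E) : Matrix (Fin 2) (Fin 2) E) =
        ((L⁻¹ : GL (Fin 2) E) : Matrix (Fin 2) (Fin 2) E) * X := rfl
    have hLinv : Matrix.det ((L⁻¹ : GL (Fin 2) E) : Matrix (Fin 2) (Fin 2) E) * Matrix.det Lm = 1 := by
      rw [← hLval, ← Matrix.det_mul, ← Units.val_mul, inv_mul_cancel, Units.val_one, Matrix.det_one]
    rw [hy, Matrix.det_mul]
    rw [hLm, det_levi] at hLinv
    -- `det X = z⁻¹ · τ z`-inverse bookkeeping: from `z = det X · τ z`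
    have hX1 : Matrix.det X * τ z = z := by rw [hX]; exact hzu.symm
    have hinvL : Matrix.det ((L⁻¹ : GL (Fin 2) E) : Matrix (Fin 2) (Fin 2) E) = (τ z) * z⁻¹ := by
      field_simp at hLinv ⊢
      linear_combination hLinv
    rw [hinvL]
    field_simp
    linear_combination hX1
  obtain ⟨g, hg⟩ := (mem_range_sl2Hom_iff_det_eq_one hφ f.injective hfix hδ y).2 hydet
  refine ⟨⟨L, hLmem⟩, z, g, hz, hLval.trans hLm, ?_⟩
  rw [hg]
  change x = ⟨L, hLmem⟩ * (⟨L, hLmem⟩⁻¹ * x)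
  rw [mul_inv_cancel_left]

end Fields

/-! ## §4 `P(F) \ U(E) ≃ ℙ¹(F)` by the bottom row -/

section Cosets

variable {F : Type*} [Field F]

/-- The bottom row of a matrix of `SL₂(F)` is non-zero (it is a point of `ℙ¹(F)`, on which `SL₂(F)` acts with the Borel
subgroup as isotropy group). [cite: Lang2002, XIII §8] -/
theorem sl2_row_one_ne_zero (g : SL(2, F)) : (g : Matrix (Fin 2) (Fin 2) F) 1 ≠ 0 := by
  intro h
  have hdet := g.det_coe
  rw [Matrix.det_fin_two] at hdet
  have h0 : (g : Matrix (Fin 2) (Fin 2) F) 1 0 = 0 := by rw [h]; rfl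
  have h1 : (g : Matrix (Fin 2) (Fin 2) F) 1 1 = 0 := by rw [h]; rfl
  rw [h0, h1] at hdet
  simp at hdet

/-- Two non-zero vectors of `F²` span the same line iff their `2 × 2` cross term vanishes: `v₀ w₁ = v₁ w₀`. [folklore] -/
private theorem projectivization_mk_eq_mk_iff_fin_two {v w : Fin 2 → F} (hv : v ≠ 0) (hw : w ≠ 0) :
    Projectivization.mk F v hv = Projectivization.mk F w hw ↔ v 0 * w 1 = v 1 * w 0 := by
  rw [Projectivization.mk_eq_mk_iff]
  constructor
  · rintro ⟨a, rfl⟩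
    simp only [Pi.smul_apply, Units.smul_def, smul_eq_mul]
    ring
  · intro h
    by_cases hw0 : w 0 = 0
    · have hw1 : w 1 ≠ 0 := by
        intro hw1; apply hw; funext i; fin_cases i <;> assumption
      have hv0 : v 0 = 0 := by
        have : v 0 * w 1 = 0 := by rw [h, hw0, mul_zero]
        exact (mul_eq_zero.1 this).resolve_right hw1
      have hv1 : v 1 ≠ 0 := by
        intro hv1; apply hv; funext i; fin_cases i <;> assumption
      refine ⟨Units.mk0 (v 1 / w 1) (div_ne_zero hv1 hw1), ?_⟩
      funext i
      fin_cases i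
      · simp [hw0, hv0]
      · simp [Units.smul_def, div_mul_cancel₀ _ hw1]
    · have hv0 : v 0 ≠ 0 := by
        intro hv0
        have : v 1 * w 0 = 0 := by rw [← h, hv0, zero_mul]
        have hv1 : v 1 = 0 := (mul_eq_zero.1 this).resolve_right hw0
        apply hv; funext i; fin_cases i <;> assumption
      refine ⟨Units.mk0 (v 0 / w 0) (div_ne_zero hv0 hw0), ?_⟩
      funext i
      fin_cases i
      · simp [Units.smul_def, div_mul_cancel₀ _ hw0]
      · simp only [Units.smul_def, Units.val_mk0, Pi.smul_apply, smul_eq_mul, Fin.mk_one, Fin.isValue]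
        field_simp
        linear_combination h

/-- Every non-zero vector of `F²` is the bottom row of a matrix of `SL₂(F)` (transitivity of `SL₂(F)` on `ℙ¹(F)`).
[cite: Lang2002, XIII §8] -/
theorem exists_sl2_row_one_eq (v : Fin 2 → F) (hv : v ≠ 0) :
    ∃ g : SL(2, F), (g : Matrix (Fin 2) (Fin 2) F) 1 = v := by
  by_cases h0 : v 0 = 0
  · have h1 : v 1 ≠ 0 := by
      intro h1; apply hv; funext i; fin_cases i <;> assumption
    refine ⟨⟨!![(v 1)⁻¹, 0; v 0, v 1], by rw [Matrix.det_fin_two]; simp [h0, h1]⟩, ?_⟩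
    funext j; fin_cases j <;> rfl
  · refine ⟨⟨!![0, -(v 0)⁻¹; v 0, v 1], by rw [Matrix.det_fin_two]; simp [h0]⟩, ?_⟩
    funext j; fin_cases j <;> rfl

variable {E : Type*} [Field E] {f : F →+* E} {τ : E →+* E} {δ : Eˣ}
variable {φ : SL(2, F) →* unitaryGroupOfForm τ (!![(0 : E), 1; 1, 0] : Matrix (Fin 2) (Fin 2) E)}
  (hφ : ∀ g : SL(2, F), (((φ g : unitaryGroupOfForm τ (!![(0 : E), 1; 1, 0] : Matrix (Fin 2) (Fin 2) E)) :
    GL (Fin 2) E) : Matrix (Fin 2) (Fin 2) E) =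
      !![f (g 0 0), f (g 0 1) * ((δ⁻¹ : Eˣ) : E); (δ : E) * f (g 1 0), f (g 1 1)])
include hφ

/-- The lower-left entry of `φ(g' g⁻¹)` is `δ · f(g'₁₀ g₁₁ − g'₁₁ g₁₀)` — `δ` times the image of the cross term of the two
bottom rows. [folklore] -/
private theorem sl2Hom_mul_inv_apply_one_zero (g g' : SL(2, F)) :
    (((φ g' * (φ g)⁻¹ : unitaryGroupOfForm τ (!![(0 : E), 1; 1, 0] : Matrix (Fin 2) (Fin 2) E)) :
      GL (Fin 2) E) : Matrix (Fin 2) (Fin 2) E) 1 0 =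
        (δ : E) * f ((g' : Matrix (Fin 2) (Fin 2) F) 1 0 * (g : Matrix (Fin 2) (Fin 2) F) 1 1 -
          (g' : Matrix (Fin 2) (Fin 2) F) 1 1 * (g : Matrix (Fin 2) (Fin 2) F) 1 0) := by
  rw [← map_inv, ← map_mul, hφ]
  simp only [Matrix.of_apply, Matrix.cons_val', Matrix.cons_val_zero, Matrix.cons_val_one,
    Matrix.cons_val_fin_one, Matrix.empty_val']
  congr 1
  rw [Matrix.SpecialLinearGroup.coe_mul, Matrix.SpecialLinearGroup.coe_inv, Matrix.adjugate_fin_two,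
    Matrix.mul_apply, Fin.sum_univ_two]
  simp
  ring

/-- **`P · φ g = P · φ g'` iff the bottom rows of `g, g'` are proportional** — for any subgroup `P ≤ U(τ, J₁)` cut out by
`x₁₀ = 0` (the Siegel ∕ Borel parabolic, supplied by the consumer): the right `P`-cosets of the image of `SL₂(F)` are
indexed by `ℙ¹(F)`. [cite: Weil1965, n° 39 (30)] -/
theorem sl2Hom_mul_inv_mem_iff (P : Subgroup (unitaryGroupOfForm τ (!![(0 : E), 1; 1, 0] : Matrix (Fin 2) (Fin 2) E)))
    (hP : ∀ x, x ∈ P ↔ ((x : GL (Fin 2) E) : Matrix (Fin 2) (Fin 2) E) 1 0 = 0) (g g' : SL(2, F)) :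
    φ g' * (φ g)⁻¹ ∈ P ↔
      Projectivization.mk F ((g : Matrix (Fin 2) (Fin 2) F) 1) (sl2_row_one_ne_zero g) =
        Projectivization.mk F ((g' : Matrix (Fin 2) (Fin 2) F) 1) (sl2_row_one_ne_zero g') := by
  rw [hP, sl2Hom_mul_inv_apply_one_zero hφ, projectivization_mk_eq_mk_iff_fin_two, mul_eq_zero,
    map_eq_zero_iff f f.injective, sub_eq_zero]
  constructor
  · rintro (h | h)
    · exact absurd h δ.ne_zero
    · linear_combination -h
  · intro h
    exact Or.inr (by linear_combination -h)

/-- **`ℙ¹(F) ≃ P(F) \ U(τ, J₁)(E)`, `[c : d] ↦ P · φ(g)` for any `g ∈ SL₂(F)` with bottom row `(c, d)`** — the index set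
of the rank-one Siegel Eisenstein series `Σ_{γ ∈ P_U(F)\U(W ⊕ W⁻)(F)} f(γ h)` on the doubled unitary group is the projective
line over the BASE field (Mathlib `Projectivization F (Fin 2 → F)`, the index type of the tree's `summable_mirabolicEisenstein`
at `n = 2`).  Hypotheses: `τ` an involution of `E` with fixed field `f(F)` and `τ δ = −δ`; `P ≤ U` any subgroup cut out by
`x₁₀ = 0`.  Stated as the existence of an `Equiv` with its characterising property. [cite: Weil1965, n° 39 (30)] -/
theorem exists_equiv_projectivization_rightCoset (hτ : ∀ x, τ (τ x) = x) (hfix : ∀ s : E, τ s = s → ∃ r : F, f r = s)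
    (hδ : τ (δ : E) = -(δ : E))
    (P : Subgroup (unitaryGroupOfForm τ (!![(0 : E), 1; 1, 0] : Matrix (Fin 2) (Fin 2) E)))
    (hP : ∀ x, x ∈ P ↔ ((x : GL (Fin 2) E) : Matrix (Fin 2) (Fin 2) E) 1 0 = 0) :
    ∃ e : Projectivization F (Fin 2 → F) ≃ Quotient (QuotientGroup.rightRel P),
      ∀ g : SL(2, F), e (Projectivization.mk F ((g : Matrix (Fin 2) (Fin 2) F) 1) (sl2_row_one_ne_zero g)) =
        Quotient.mk (QuotientGroup.rightRel P) (φ g) := by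
  classical
  -- a matrix of `SL₂(F)` over each point of `ℙ¹(F)`
  let lift : Projectivization F (Fin 2 → F) → SL(2, F) := fun ξ =>
    Classical.choose (exists_sl2_row_one_eq ξ.rep ξ.rep_nonzero)
  have hlift : ∀ ξ, (lift ξ : Matrix (Fin 2) (Fin 2) F) 1 = ξ.rep := fun ξ =>
    Classical.choose_spec (exists_sl2_row_one_eq ξ.rep ξ.rep_nonzero)
  have hmk : ∀ ξ, Projectivization.mk F ((lift ξ : Matrix (Fin 2) (Fin 2) F) 1) (sl2_row_one_ne_zero (lift ξ)) = ξ := by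
    intro ξ
    simp_rw [hlift ξ]
    exact ξ.mk_rep
  let toC : Projectivization F (Fin 2 → F) → Quotient (QuotientGroup.rightRel P) := fun ξ =>
    Quotient.mk (QuotientGroup.rightRel P) (φ (lift ξ))
  -- the key compatibility: any `g` over `ξ` gives the same coset
  have key : ∀ (g : SL(2, F)),
      toC (Projectivization.mk F ((g : Matrix (Fin 2) (Fin 2) F) 1) (sl2_row_one_ne_zero g)) =
        Quotient.mk (QuotientGroup.rightRel P) (φ g) := by
    intro g
    exact Quotient.sound (QuotientGroup.rightRel_apply.2 ((sl2Hom_mul_inv_mem_iff hφ P hP _ _).2 (hmk _)))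
  have hinj : Function.Injective toC := by
    intro ξ ξ' h
    have h' : φ (lift ξ') * (φ (lift ξ))⁻¹ ∈ P := QuotientGroup.rightRel_apply.1 (Quotient.exact h)
    rw [sl2Hom_mul_inv_mem_iff hφ P hP, hmk, hmk] at h'
    exact h'
  have hsurj : Function.Surjective toC := by
    intro q
    obtain ⟨x, rfl⟩ := Quotient.mk_surjective q
    obtain ⟨m, z, g, hz, hm, hx⟩ := exists_levi_mul_sl2 hφ hτ hfix hδ x
    refine ⟨Projectivization.mk F ((g : Matrix (Fin 2) (Fin 2) F) 1) (sl2_row_one_ne_zero g), ?_⟩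
    rw [key]
    refine Quotient.sound (QuotientGroup.rightRel_apply.2 ?_)
    rw [hx, mul_inv_cancel_right, hP, hm]
    rfl
  exact ⟨Equiv.ofBijective toC ⟨hinj, hsurj⟩, key⟩

/-- `tsum` RE-INDEXING COROLLARY: a series over the right cosets `P \ U(E)` is the series over `ℙ¹(F)` of its values at
`P · φ(g_ξ)` — the shape in which the rank-one Siegel Eisenstein series meets `summable_mirabolicEisenstein` (`n = 2`).
[cite: Weil1965, n° 39 (30)] -/
theorem exists_tsum_rightCoset_eq_tsum_projectivization (hτ : ∀ x, τ (τ x) = x)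
    (hfix : ∀ s : E, τ s = s → ∃ r : F, f r = s) (hδ : τ (δ : E) = -(δ : E))
    (P : Subgroup (unitaryGroupOfForm τ (!![(0 : E), 1; 1, 0] : Matrix (Fin 2) (Fin 2) E)))
    (hP : ∀ x, x ∈ P ↔ ((x : GL (Fin 2) E) : Matrix (Fin 2) (Fin 2) E) 1 0 = 0) :
    ∃ e : Projectivization F (Fin 2 → F) ≃ Quotient (QuotientGroup.rightRel P),
      (∀ g : SL(2, F), e (Projectivization.mk F ((g : Matrix (Fin 2) (Fin 2) F) 1) (sl2_row_one_ne_zero g)) =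
        Quotient.mk (QuotientGroup.rightRel P) (φ g)) ∧
      ∀ {M : Type*} [AddCommMonoid M] [TopologicalSpace M] (u : Quotient (QuotientGroup.rightRel P) → M),
        ∑' q, u q = ∑' ξ : Projectivization F (Fin 2 → F), u (e ξ) := by
  obtain ⟨e, he⟩ := exists_equiv_projectivization_rightCoset hφ hτ hfix hδ P hP
  exact ⟨e, he, fun u => (e.tsum_eq u).symm⟩

end Cosets

end RankOneSL2

end DoubledUnitary

end Literature.NumberTheory.Automorphic
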